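/-
Copyright (c) 2026. Released under Apache 2.0 license.
-/
import Literature.Analysis.ValidatedNumerics.FixedPointInterval
import Mathlib.Analysis.Complex.ExponentialBounds
import HarnessLib

/-!
# Motivic door, semi-local ladder — kernel-checked numerics for the quintic certificate

Pub speedrun, cell `pub-rhdoor`, seat `lad-2`, generation 4 (the KERNEL file of rung R3⁻(0.59)).
All inequalities between explicit real numbers that the certificate
`MotivicDoorSemilocalQuinticBound.lean` needs are proved here by evaluating closed Boolean
terms of the fixed-point interval engine `Literature.Analysis.ValidatedNumerics.Numerics.FI`
(scale `2^48`) with `decide +kernel`, together with their soundness theorems: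

* `chunkR_le_of_check` + `checkChunk_one/two/three`: the three blocks of the zeroth-order upper
  Riemann sum `Σ_i w(a_i) (IΔ(τ_{i+1}) - IΔ(τ_i))`, `a_i = i/2000`, `τ_i = i/1178`, `i = 1 … 2355`,
  where `w(t) = e^{-t/2}/(1 - e^{-2t})` and `IΔ = hornerR iL` is the antiderivative of the
  increment polynomial;
* `hornerR_dL_log_two_le`: `Δ(log 2 / b) ≤ B_D / 2^48`;
* `tailT_le`: `2e^{-b} + (2/5)e^{-5b} + (2/9)e^{-9b}/(1 - e^{-4b}) ≤ B_T / 2^48`, `b = 0.589`;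
* `kLo_le_kSum`: `K_lo / 2^48 ≤ Σ_{m<200} (2/(4m+1) - 1/(2m+1))`.

PROVED: everything (sorry-free; `decide +kernel` only, no `native_decide`).
-/

set_option linter.dupNamespace false

noncomputable section

open Real Finset
open Literature.Analysis.ValidatedNumerics.Numerics

namespace Summit.RiemannHypothesis.RiemannHypothesis.Theorems.MotivicDoor.SemilocalKernel

/-! ## Horner evaluation over `FI` -/

/-- Horner evaluation of a rational coefficient list (real side). -/
def hornerR : List ℚ → ℝ → ℝ
  | [], _ => 0
  | c :: l, x => (c : ℝ) + x * hornerR l x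

/-- A rational number as a (one-ulp) interval. -/
def ofRat (q : ℚ) : FI := FI.ofFrac q.num q.den

/-- Soundness of `ofRat`. -/
theorem mem_ofRat (q : ℚ) : FI.mem (q : ℝ) (ofRat q) := by
  have h := FI.mem_ofFrac q.num (q := q.den) q.pos
  rw [ofRat]
  convert h using 1
  rw [Rat.cast_def]

/-- Horner evaluation of a rational coefficient list (interval side). -/
def hornerFI : List ℚ → FI → FI
  | [], _ => FI.ofInt 0
  | c :: l, X => (ofRat c).add (X.mul (hornerFI l X))

/-- Soundness of `hornerFI`. -/
theorem mem_hornerFI {x : ℝ} {X : FI} (hx : FI.mem x X) :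
    ∀ l : List ℚ, FI.mem (hornerR l x) (hornerFI l X)
  | [] => by simpa [hornerR, hornerFI] using FI.mem_ofInt 0
  | c :: l => by
      simp only [hornerR, hornerFI]
      exact FI.mem_add (mem_ofRat c) (FI.mem_mul hx (mem_hornerFI hx l))

/-- `1 ∈ ofInt 1`. -/
theorem mem_one : FI.mem (1 : ℝ) (FI.ofInt 1) := by simpa using FI.mem_ofInt 1

/-! ## Data -/

/-- `Δ / τ`. -/
def qL : List ℚ := [64, 7332, -46322/3, 8820, 501/2, 0, -27621/28, 0, 765/4, 0, -567/44]

/-- The increment polynomial `Δ`. -/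
def dL : List ℚ := 0 :: qL

/-- The antiderivative `IΔ` of `Δ` (`IΔ(0) = 0`). -/
def iL : List ℚ := [0, 0, 32, 2444, -23161/6, 1764, 167/4, 0, -27621/224, 0, 153/8, 0, -189/176]

/-- The archimedean density in closed form, `w(t) = e^{-t/2} / (1 - (e^{-t/2})⁴)`. -/
def wR (t : ℝ) : ℝ := Real.exp (-(t / 2)) / (1 - Real.exp (-(t / 2)) ^ 4)

/-- Cell term `w(i/2000) · (IΔ((i+1)/1178) - IΔ(i/1178))` (real side). -/
def cellR (i : ℕ) : ℝ :=
  wR ((i : ℝ) / 2000) * (hornerR iL (((i : ℝ) + 1) / 1178) - hornerR iL ((i : ℝ) / 1178))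

/-- Block sum `Σ_{k<n} cellR (i₀ + k)` by structural recursion (real side). -/
def chunkR : ℕ → ℕ → ℝ
  | _, 0 => 0
  | i0, n + 1 => cellR i0 + chunkR (i0 + 1) n

/-- `chunkR` is the block sum. -/
theorem chunkR_eq_sum (i0 n : ℕ) : chunkR i0 n = ∑ k ∈ range n, cellR (i0 + k) := by
  induction n generalizing i0 with
  | zero => simp [chunkR]
  | succ n ih =>
    rw [chunkR, ih, Finset.sum_range_succ', add_comm, Nat.add_zero]
    refine congrArg₂ (· + ·) (Finset.sum_congr rfl fun k _ ↦ by rw [Nat.add_right_comm, Nat.add_assoc]) rfl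

/-- Enclosure of `w(i/2000)` (interval side; `none` if the engine declines). -/
def wFI (i : ℕ) : Option FI :=
  match FI.expSmall (FI.ofFrac (-(i : ℤ)) 4000) with
  | none => none
  | some E => FI.divPos E ((FI.ofInt 1).sub (FI.sqr (FI.sqr E)))

/-- `τ_i = i / 1178` as an interval. -/
def tauFI (i : ℕ) : FI := FI.ofFrac (i : ℤ) 1178

/-- Enclosure of `cellR i`. -/
def cellFI (i : ℕ) : Option FI :=
  match wFI i with
  | none => none
  | some W => some (W.mul ((hornerFI iL (tauFI (i + 1))).sub (hornerFI iL (tauFI i))))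

/-- Enclosure of `chunkR i₀ n`. -/
def chunkFI : ℕ → ℕ → Option FI
  | _, 0 => some (FI.ofInt 0)
  | i0, n + 1 =>
    match cellFI i0, chunkFI (i0 + 1) n with
    | some C, some S => some (C.add S)
    | _, _ => none

/-- The block check: the upper endpoint of the enclosure of `chunkR i₀ n` is at most `B`. -/
def checkChunk (i0 n : ℕ) (B : ℤ) : Bool :=
  match chunkFI i0 n with
  | some S => decide (S.hi ≤ B)
  | none => false

/-! ## Soundness -/

/-- Soundness of `wFI`. -/
theorem mem_wFI {i : ℕ} {W : FI} (h : wFI i = some W) : FI.mem (wR ((i : ℝ) / 2000)) W := by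
  unfold wFI at h
  split at h
  · exact absurd h (by simp)
  · rename_i E hE
    have hx : FI.mem (-((i : ℝ) / 2000 / 2)) (FI.ofFrac (-(i : ℤ)) 4000) := by
      have := FI.mem_ofFrac (-(i : ℤ)) (q := 4000) (by norm_num)
      convert this using 1; push_cast; ring
    have hE' := FI.mem_expSmall hE hx
    have h4 : FI.mem (Real.exp (-((i : ℝ) / 2000 / 2)) ^ 4) (FI.sqr (FI.sqr E)) := by
      rw [show (4 : ℕ) = 2 * 2 by norm_num, pow_mul]
      exact FI.mem_sqr (FI.mem_sqr hE')
    exact FI.mem_divPos h hE' (FI.mem_sub mem_one h4)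

/-- Soundness of `tauFI`. -/
theorem mem_tauFI (i : ℕ) : FI.mem ((i : ℝ) / 1178) (tauFI i) := by
  have := FI.mem_ofFrac (i : ℤ) (q := 1178) (by norm_num)
  rw [tauFI]
  convert this using 1; push_cast; ring

/-- Soundness of `cellFI`. -/
theorem mem_cellFI {i : ℕ} {C : FI} (h : cellFI i = some C) : FI.mem (cellR i) C := by
  unfold cellFI at h
  split at h
  · exact absurd h (by simp)
  · rename_i W hW
    rw [Option.some.injEq] at h
    subst h
    refine FI.mem_mul (mem_wFI hW) (FI.mem_sub ?_ (mem_hornerFI (mem_tauFI i) iL))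
    have := mem_hornerFI (mem_tauFI (i + 1)) iL
    convert this using 2; push_cast; ring

/-- Soundness of `chunkFI`. -/
theorem mem_chunkFI : ∀ (i0 n : ℕ) {S : FI}, chunkFI i0 n = some S → FI.mem (chunkR i0 n) S
  | i0, 0, S, h => by
      simp only [chunkFI, Option.some.injEq] at h
      subst h; simpa [chunkR] using FI.mem_ofInt 0
  | i0, n + 1, S, h => by
      unfold chunkFI at h
      split at h
      · rename_i C T hC hT
        rw [Option.some.injEq] at h
        subst h
        rw [chunkR]
        exact FI.mem_add (mem_cellFI hC) (mem_chunkFI (i0 + 1) n hT)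
      · exact absurd h (by simp)

/-- Soundness of the block check. -/
theorem chunkR_le_of_check {i0 n : ℕ} {B : ℤ} (h : checkChunk i0 n B = true) :
    chunkR i0 n ≤ (B : ℝ) / SC := by
  unfold checkChunk at h
  split at h
  · rename_i S hS
    have hm := mem_chunkFI i0 n hS
    have hB : S.hi ≤ B := of_decide_eq_true h
    refine (FI.le_hi_div hm).trans ?_
    exact div_le_div_of_nonneg_right (by exact_mod_cast hB) SC_pos.le
  · exact absurd h (by simp)

/-! ## The three blocks (kernel evaluation) -/

/-- Scaled upper bound of block 1 (`i = 1 … 785`). -/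
def B1 : ℤ := 153458347398895648
/-- Scaled upper bound of block 2 (`i = 786 … 1570`). -/
def B2 : ℤ := 59774490472097000
/-- Scaled upper bound of block 3 (`i = 1571 … 2355`). -/
def B3 : ℤ := 53389849271061448

set_option maxHeartbeats 0 in
/-- Block 1 passes. -/
theorem checkChunk_one : checkChunk 1 785 B1 = true := by
  decide +kernel

set_option maxHeartbeats 0 in
/-- Block 2 passes. -/
theorem checkChunk_two : checkChunk 786 785 B2 = true := by
  decide +kernel

set_option maxHeartbeats 0 in
/-- Block 3 passes. -/
theorem checkChunk_three : checkChunk 1571 785 B3 = true := by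
  decide +kernel

/-- The bulk Riemann sum is at most `(B1 + B2 + B3) / 2^48 ≈ 947.234`. -/
theorem bulk_le :
    chunkR 1 785 + chunkR 786 785 + chunkR 1571 785 ≤ ((B1 + B2 + B3 : ℤ) : ℝ) / SC := by
  have h1 := chunkR_le_of_check checkChunk_one
  have h2 := chunkR_le_of_check checkChunk_two
  have h3 := chunkR_le_of_check checkChunk_three
  push_cast at h1 h2 h3 ⊢
  have := SC_pos
  rw [add_div, add_div]
  linarith

/-! ## `Δ(log 2 / b)` -/

/-- Interval for `τ* = log 2 / 0.589` from `0.6931471803 < log 2 < 0.6931471808`. -/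
def tauStar : FI := ⟨331245477813241, 331245478052186⟩

/-- `log 2 / b ∈ tauStar`. -/
theorem mem_tauStar : FI.mem (Real.log 2 / (589 / 1000)) tauStar := by
  have h1 := Real.log_two_gt_d9
  have h2 := Real.log_two_lt_d9
  rw [FI.mem_def, tauStar, SC]
  push_cast
  constructor <;> nlinarith

/-- Scaled upper bound for `Δ(τ*)` (`Δ(τ*) = 213.4350…`, slack `10⁻³`). -/
def BD : ℤ := 60076909839821992

set_option maxHeartbeats 0 in
/-- The `Δ(τ*)` check passes. -/
theorem checkD : decide ((hornerFI dL tauStar).hi ≤ BD) = true := by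
  decide +kernel

/-- `Δ(log 2 / b) ≤ BD / 2^48`. -/
theorem hornerR_dL_log_two_le : hornerR dL (Real.log 2 / (589 / 1000)) ≤ (BD : ℝ) / SC := by
  have hm := mem_hornerFI mem_tauStar dL
  refine (FI.le_hi_div hm).trans ?_
  exact div_le_div_of_nonneg_right (by exact_mod_cast of_decide_eq_true checkD) SC_pos.le

/-! ## The tail constant -/

/-- `T(e) = 2e + (2/5) e⁵ + (2/9) e⁹ / (1 - e⁴)` (real side). -/
def tailT (e : ℝ) : ℝ := 2 * e + 2 / 5 * (e * e ^ 4) + 2 / 9 * (e * (e ^ 4) ^ 2) / (1 - e ^ 4)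

/-- Enclosure of `T(e^{-0.589})`. -/
def tailFI : Option FI :=
  match FI.expSmall (FI.ofFrac (-589) 1000) with
  | none => none
  | some E =>
    let E4 := FI.sqr (FI.sqr E)
    match FI.divPos ((ofRat (2 / 9)).mul (E.mul (FI.sqr E4))) ((FI.ofInt 1).sub E4) with
    | none => none
    | some Q => some (((ofRat 2).mul E).add (((ofRat (2 / 5)).mul (E.mul E4)).add Q))

/-- Scaled upper bound for the tail constant (`T = 1.13202878…`, slack `10⁻⁷`). -/
def BT : ℤ := 318637804885590

/-- The tail check. -/
def checkT : Bool := match tailFI with | some T => decide (T.hi ≤ BT) | none => false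

set_option maxHeartbeats 0 in
/-- The tail check passes. -/
theorem checkT_true : checkT = true := by
  decide +kernel

/-- `T(e^{-b}) ≤ BT / 2^48`. -/
theorem tailT_le : tailT (Real.exp (-(589 / 1000))) ≤ (BT : ℝ) / SC := by
  have h := checkT_true
  unfold checkT at h
  split at h
  · rename_i T hT
    have hB : T.hi ≤ BT := of_decide_eq_true h
    suffices hm : FI.mem (tailT (Real.exp (-(589 / 1000)))) T by
      refine (FI.le_hi_div hm).trans ?_
      exact div_le_div_of_nonneg_right (by exact_mod_cast hB) SC_pos.le
    unfold tailFI at hT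
    split at hT
    · exact absurd hT (by simp)
    · rename_i E hE
      have hx : FI.mem (-(589 / 1000 : ℝ)) (FI.ofFrac (-589) 1000) := by
        have := FI.mem_ofFrac (-589) (q := 1000) (by norm_num)
        convert this using 1; push_cast; ring
      have he := FI.mem_expSmall hE hx
      set e := Real.exp (-(589 / 1000 : ℝ))
      have h4 : FI.mem (e ^ 4) (FI.sqr (FI.sqr E)) := by
        rw [show (4 : ℕ) = 2 * 2 by norm_num, pow_mul]; exact FI.mem_sqr (FI.mem_sqr he)
      simp only at hT
      split at hT
      · exact absurd hT (by simp)
      · rename_i Q hQ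
        rw [Option.some.injEq] at hT
        subst hT
        have hq := FI.mem_divPos hQ
          (FI.mem_mul (mem_ofRat (2 / 9)) (FI.mem_mul he (FI.mem_sqr h4)))
          (FI.mem_sub mem_one h4)
        have := FI.mem_add (FI.mem_mul (mem_ofRat 2) he)
          (FI.mem_add (FI.mem_mul (mem_ofRat (2 / 5)) (FI.mem_mul he h4)) hq)
        convert this using 1
        simp only [tailT]; push_cast; ring
  · exact absurd h (by simp)

/-! ## The killing sum -/

/-- `K_M = Σ_{m<M} (2/(4m+1) - 1/(2m+1))` (real side). -/
def kSum (M : ℕ) : ℝ := ∑ m ∈ range M, ((2 : ℝ) / (4 * m + 1) - 1 / (2 * m + 1))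

/-- Enclosure of `K_M` by structural recursion. -/
def kSumFI : ℕ → FI
  | 0 => FI.ofInt 0
  | m + 1 => (kSumFI m).add ((FI.ofFrac 2 (4 * m + 1)).sub (FI.ofFrac 1 (2 * m + 1)))

/-- Soundness of `kSumFI`. -/
theorem mem_kSumFI : ∀ M : ℕ, FI.mem (kSum M) (kSumFI M)
  | 0 => by simpa [kSum, kSumFI] using FI.mem_ofInt 0
  | m + 1 => by
      rw [kSum, Finset.sum_range_succ, kSumFI]
      refine FI.mem_add (mem_kSumFI m) (FI.mem_sub ?_ ?_)
      · have := FI.mem_ofFrac 2 (q := 4 * m + 1) (by omega)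
        convert this using 1; push_cast; ring
      · have := FI.mem_ofFrac 1 (q := 2 * m + 1) (by omega)
        convert this using 1; push_cast; ring

/-- Scaled lower bound for `K_200 = 1.1313463640…`. -/
def KL : ℤ := 318445691185836

set_option maxHeartbeats 0 in
/-- The killing-sum check passes. -/
theorem checkK : decide (KL ≤ (kSumFI 200).lo) = true := by
  decide +kernel

/-- `KL / 2^48 ≤ K_200`. -/
theorem kLo_le_kSum : (KL : ℝ) / SC ≤ kSum 200 := by
  have hm := mem_kSumFI 200
  refine le_trans ?_ (FI.lo_div_le hm)
  exact div_le_div_of_nonneg_right (by exact_mod_cast of_decide_eq_true checkK) SC_pos.le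

end Summit.RiemannHypothesis.RiemannHypothesis.Theorems.MotivicDoor.SemilocalKernel

end
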